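import Literature.MathematicalPhysics.QuantumFieldTheory.Balaban1983to89.B1Eq324BenfattoSect5Eq511
import HarnessLib

/-!
# `Balaban1983to89.B1Eq324BenfattoSect5Eq524` — [BenfattoEtAl1978] §5 p. 157 (5.23)–(5.24) and (5.27): the inner corridors `Γ₃(□) ⊂ Γ₂(□)`,
# `Γ₄(□) ⊂ □′`, the decomposition `Ψ_□ = Ψ₁ + Ψ₂ + Ψ₃`, the bound (5.24) «|H′^{(l)}χ^□_b| ≦ s₁Ab^{D+2d}e^{−(ϰ/8)b^{3/2}}» PROVED for the
# tree's objects, and (5.27)'s `Ψ₁ = Ψ′₁ + Ψ″₁` with «each monomial of Ψ″₁ contains at least one z_Δ with Δ ⊂ □′∖Γ₄(□)»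

statement-level skeleton of published theorems with citation tags; proofs where landed; nothing here is a claim about the
Yang–Mills mass gap

WHY THIS MODULE (cell `pub-ymgap`, seat `dag-n08-d` gen 8, INTENT-21; node N08 [Balaban1985UV3]; the [BenfattoEtAl1978] source chain behind
the (α)-row `h324c`; dag-lead DEDUP-295: the structural (5.23)/(5.24)/(5.27) are this seat's, (5.25)/(5.26)/(5.28)–(5.33) the cumulant side's).
Print, p. 157 (render `lit-balaban-typer/renders/benfatto1978-cmp59/bcg_p157_s3.png`, read first-hand): *"Consider 𝓔^T_{z_{Γ₁}}(Ψ_□χ^□_b; k)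
and decompose Ψ_□ as Ψ_□ = (H_{□′} + H_{□′,Γ₃(□)}) + (H_{Γ₁(□),Γ₂(□)} + H_{Γ₂(□)}) + H′^{(l)} (5.23) where Γ₃(□) is a corridor adjacent to □′
with width ½b^{3/2} [hence Γ₃(□) ⊂ Γ₂(□)] (see Fig. 1) and H′^{(l)} can be bounded by |H′^{(l)}χ^□_b| ≦ s₁Ab^{D+2d}e^{−(ϰ/8)b^{3/2}}. (5.24)
We denote the three addends in (5.23) Ψ₁, Ψ₂, Ψ₃ respectively … To treat the second term we define Γ₄(□) as the corridor adjacent to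
the boundary of □′ contained inside □′ and with width b^{3/2}/2 and decompose Ψ₁ as Ψ′₁ + Ψ″₁ where Ψ′₁ = H_{Γ₄(□)} + H_{Γ₄(□),Γ₃(□)}. (5.27)
The feature of Ψ″₁ to be retained is that in its expression as a polynomial in the z_Δ's each monomials contains at least one z_Δ with
Δ ⊂ □′∖Γ₄(□)."*

WHAT IS HERE (standard axioms; no `sorry`; definition lane for the printed objects).  DEFS `annulus` (the general corridor
`shrink j ∖ shrink k`; `frame1_eq_annulus`, `frame2_eq_annulus`), `frame3` (Γ₃(□), width `v`; print `v = w/2`), `frame4` (Γ₄(□)), `psi1`,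
`psi2`, `psi3` (the addends of (5.23); `psi3 := Ψ_□ − Ψ₁ − Ψ₂`), `psi1p`, `psi1pp` ((5.27)), `crossT` (the tuple class of an interaction).
THEOREMS `psiBox_eq_psi1_add_psi2_add_psi3` ((5.23) as an identity), ★ `psi3_eq_interaction_sub` (`H′^{(l)} = H_{□′,Γ₂} − H_{□′,Γ₃}`),
`interaction_eq_sum_crossT`, ★ `psi3_eq_sum` (tuple form), `le_cubeDist_of_mem_shrink_of_not_mem_shrink` (separation across a corridor,
general form), ★ `le_connLength_of_mem_psi3Class` (`d(Δ) ≥ v`), ★ `sum_exp_anchored_le` (anchored counting), `card_filter_coe_mem_le`,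
`card_shrink_le` (`|□′∪Γ₂| ≤ L^d`), ★★ `abs_psi3_le` = (5.24): `|Ψ₃(z)| ≤ s₁·A·b^D·e^{−(ϰ/4)v}·|□′∪Γ₂(□)|` and `abs_psi3_le'` (… `·L^d`;
print: `v = ½b^{3/2}`, `L = b²` ⇒ `s₁Ab^{D+2d}e^{−(ϰ/8)b^{3/2}}`); (5.27): `crossT_frame4_subset`, ★ `psi1pp_eq_sum` (tuple form of `Ψ″₁`),
★ `exists_mem_core_sdiff_frame4` («each monomial contains a z_Δ with Δ ⊂ □′∖Γ₄(□)»); v1.1 §5 `psi3_congr_coef`,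
★ `abs_psi3_le_of_range` (coefficient bound only on the range of (4.5)).
HONEST SCOPE as in `…Sect5Eq511`; count-neutral for N08; `BasicLemmaPrinted` NOT discharged; nothing about d = 4, the continuum, OS
axioms, a mass gap or the Clay problem.
-/

noncomputable section

open Finset
open scoped BigOperators

namespace Literature.MathematicalPhysics.QuantumFieldTheory.Balaban1983to89.B1Eq324BenfattoSect5Eq524

open Literature.MathematicalPhysics.QuantumFieldTheory.Balaban1983to89.B3Sect3VectorSelfEnergy
open Literature.MathematicalPhysics.QuantumFieldTheory.Balaban1983to89.B1Eq324BenfattoLemma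
open Literature.MathematicalPhysics.QuantumFieldTheory.Balaban1983to89.B1Eq324BenfattoConnLength
open Literature.MathematicalPhysics.QuantumFieldTheory.Balaban1983to89.B1Eq324BenfattoSect5Boxes
open Literature.MathematicalPhysics.QuantumFieldTheory.Balaban1983to89.B1Eq324BenfattoSect5Eq511

variable {d : ℕ}

/-! ## §1  (5.23)/(5.27): the inner corridors `Γ₃(□) ⊂ Γ₂(□)`, `Γ₄(□) ⊂ □′` and the three addends of `Ψ_□` -/

/-- **A general corridor of the tessera**: the sites of `□_m` at depth in `[j, k)`, `shrink j ∖ shrink k` (`Γ₁ = annulus 0 w`,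
`Γ₂ = annulus w 2w`). [cite: BenfattoEtAl1978, (5.7) p.154, (5.23) p.157] -/
def annulus (L : ℕ) (m : B1Eq324BenfattoLemma.Site d) (j k : ℕ) : Finset (B1Eq324BenfattoLemma.Site d) :=
  shrink L m j \ shrink L m k

/-- `Γ₁(□) = annulus 0 w`. [cite: BenfattoEtAl1978, (5.7) p.154] -/
theorem frame1_eq_annulus (L w : ℕ) (m : B1Eq324BenfattoLemma.Site d) : frame1 L w m = annulus L m 0 w := by
  rw [frame1, annulus, shrink_zero]

/-- `Γ₂(□) = annulus w 2w`. [cite: BenfattoEtAl1978, (5.7) p.154] -/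
theorem frame2_eq_annulus (L w : ℕ) (m : B1Eq324BenfattoLemma.Site d) : frame2 L w m = annulus L m w (2 * w) := rfl

/-- **Γ₃(□)** — *"a corridor adjacent to □′ with width ½b^{3/2} [hence Γ₃(□) ⊂ Γ₂(□)]"*: the innermost part of `Γ₂(□)` of width `v`
(print: `v = w/2`): `annulus (2w − v) 2w`. [cite: BenfattoEtAl1978, (5.23) p.157] -/
def frame3 (L w v : ℕ) (m : B1Eq324BenfattoLemma.Site d) : Finset (B1Eq324BenfattoLemma.Site d) :=
  annulus L m (2 * w - v) (2 * w)

/-- **Γ₄(□)** — *"the corridor adjacent to the boundary of □′ contained inside □′ and with width b^{3/2}/2"*: `annulus 2w (2w + v)`.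
[cite: BenfattoEtAl1978, (5.27) p.157] -/
def frame4 (L w v : ℕ) (m : B1Eq324BenfattoLemma.Site d) : Finset (B1Eq324BenfattoLemma.Site d) :=
  annulus L m (2 * w) (2 * w + v)

/-- `Γ₃(□) ⊆ Γ₂(□)` (for `v ≤ w`). [cite: BenfattoEtAl1978, (5.23) p.157] -/
theorem frame3_subset_frame2 (L : ℕ) {w v : ℕ} (hv : v ≤ w) (m : B1Eq324BenfattoLemma.Site d) : frame3 L w v m ⊆ frame2 L w m := by
  rw [frame3, frame2, annulus]
  exact Finset.sdiff_subset_sdiff (shrink_mono L m (by omega)) le_rfl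

/-- `Γ₄(□) ⊆ □′`. [cite: BenfattoEtAl1978, (5.27) p.157] -/
theorem frame4_subset_core (L w v : ℕ) (m : B1Eq324BenfattoLemma.Site d) : frame4 L w v m ⊆ core L w m := by
  rw [frame4, annulus, core]
  exact Finset.sdiff_subset

/-- `□′ ∩ Γ₂(□) = ∅`. [cite: BenfattoEtAl1978, (5.7) p.154] -/
theorem disjoint_core_frame3 (L w v : ℕ) (m : B1Eq324BenfattoLemma.Site d) : Disjoint (core L w m) (frame3 L w v m) := by
  rw [core, frame3, annulus]
  exact Finset.disjoint_sdiff

/-- `□′ ∪ Γ₃(□) = shrink (2w − v)`. [cite: BenfattoEtAl1978, (5.23) p.157] -/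
theorem core_union_frame3 (L w v : ℕ) (m : B1Eq324BenfattoLemma.Site d) : core L w m ∪ frame3 L w v m = shrink L m (2 * w - v) := by
  rw [core, frame3, annulus, Finset.union_sdiff_of_subset (shrink_mono L m (Nat.sub_le _ _))]

/-- `□′ ∖ Γ₄(□) = shrink (2w + v)`. [cite: BenfattoEtAl1978, (5.27) p.157] -/
theorem core_sdiff_frame4 (L w v : ℕ) (m : B1Eq324BenfattoLemma.Site d) : core L w m \ frame4 L w v m = shrink L m (2 * w + v) := by
  rw [core, frame4, annulus, sdiff_sdiff_right_self, Finset.inf_eq_inter,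
    Finset.inter_eq_right.mpr (shrink_mono L m (Nat.le_add_right _ _))]

variable (s D : ℕ) (κ : ℝ) (a : Coef d) (L w v : ℕ) (m : B1Eq324BenfattoLemma.Site d)

/-- **Ψ₁ = H_{□′} + H_{□′,Γ₃(□)}** — the first addend of (5.23). [cite: BenfattoEtAl1978, (5.23) p.157] -/
def psi1 (z : B1Eq324BenfattoLemma.Site d → ℝ) : ℝ :=
  hamiltonian s D κ a (core L w m) z + interaction s D κ a (core L w m) (frame3 L w v m) z

/-- **Ψ₂ = H_{Γ₁(□),Γ₂(□)} + H_{Γ₂(□)}** — the second addend of (5.23). [cite: BenfattoEtAl1978, (5.23) p.157] -/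
def psi2 (z : B1Eq324BenfattoLemma.Site d → ℝ) : ℝ :=
  interaction s D κ a (frame1 L w m) (frame2 L w m) z + hamiltonian s D κ a (frame2 L w m) z

/-- **Ψ₃ = H′^{(l)} := Ψ_□ − Ψ₁ − Ψ₂** — the third addend of (5.23) (the part of `Ψ_□` reaching from `□′` across `Γ₃(□)`; bounded in (5.24)).
[cite: BenfattoEtAl1978, (5.23) p.157] -/
def psi3 (z : B1Eq324BenfattoLemma.Site d → ℝ) : ℝ :=
  psiBox s D κ a L w m z - psi1 s D κ a L w v m z - psi2 s D κ a L w m z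

/-- **(5.23) as an identity**: `Ψ_□ = Ψ₁ + Ψ₂ + Ψ₃`. [cite: BenfattoEtAl1978, (5.23) p.157] -/
theorem psiBox_eq_psi1_add_psi2_add_psi3 (z : B1Eq324BenfattoLemma.Site d → ℝ) :
    psiBox s D κ a L w m z = psi1 s D κ a L w v m z + psi2 s D κ a L w m z + psi3 s D κ a L w v m z := by
  rw [psi3]
  ring

/-- **Ψ′₁ = H_{Γ₄(□)} + H_{Γ₄(□),Γ₃(□)}** (5.27). [cite: BenfattoEtAl1978, (5.27) p.157] -/
def psi1p (z : B1Eq324BenfattoLemma.Site d → ℝ) : ℝ :=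
  hamiltonian s D κ a (frame4 L w v m) z + interaction s D κ a (frame4 L w v m) (frame3 L w v m) z

/-- **Ψ″₁ = Ψ₁ − Ψ′₁** (5.27). [cite: BenfattoEtAl1978, (5.27) p.157] -/
def psi1pp (z : B1Eq324BenfattoLemma.Site d → ℝ) : ℝ :=
  psi1 s D κ a L w v m z - psi1p s D κ a L w v m z

/-- **`H′^{(l)} = H_{□′,Γ₂(□)} − H_{□′,Γ₃(□)}`** — the third addend of (5.23) is the interaction of the core with the FAR part `Γ₂ ∖ Γ₃` of the
second corridor (pure algebra from (5.6), (5.10) and `□′ ∪ Γ₂(□) = shrink w`). [cite: BenfattoEtAl1978, (5.23) p.157] -/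
theorem psi3_eq_interaction_sub (z : B1Eq324BenfattoLemma.Site d → ℝ) :
    psi3 s D κ a L w v m z = interaction s D κ a (core L w m) (frame2 L w m) z
      - interaction s D κ a (core L w m) (frame3 L w v m) z := by
  simp only [psi3, psi1, psi2, psiBox, interaction, core_union_frame2, Finset.union_comm (frame1 L w m) (frame2 L w m)]
  ring

variable {s D κ a L w v m}

/-! ## §2  Interactions as sums over crossing tuples -/

section Cross

variable (J : Finset (B1Eq324BenfattoLemma.Site d)) (p : ℕ)

/-- **The crossing tuples of two regions**: inside `R ∪ S`, meeting both (`Sect5Eq511.crossTuples` is the `Γ₂(□)`/`Γ₁(□)` instance).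
[cite: BenfattoEtAl1978, (5.6) p.154] -/
def crossT (R S : Finset (B1Eq324BenfattoLemma.Site d)) : Finset (Fin p → J) :=
  tuplesIn J p (R ∪ S) \ (tuplesIn J p R ∪ tuplesIn J p S)

variable {J p}

/-- Membership in the crossing class: inside `R ∪ S`, not inside `R`, not inside `S`. [cite: BenfattoEtAl1978, (5.6) p.154] -/
theorem mem_crossT {R S : Finset (B1Eq324BenfattoLemma.Site d)} {Δ : Fin p → J} :
    Δ ∈ crossT J p R S ↔ (∀ i, (Δ i : B1Eq324BenfattoLemma.Site d) ∈ R ∪ S) ∧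
      ¬ (∀ i, (Δ i : B1Eq324BenfattoLemma.Site d) ∈ R) ∧ ¬ (∀ i, (Δ i : B1Eq324BenfattoLemma.Site d) ∈ S) := by
  rw [crossT, Finset.mem_sdiff, Finset.mem_union, not_or, mem_tuplesIn, mem_tuplesIn, mem_tuplesIn]

variable {s D : ℕ} {κ : ℝ} {a : Coef d} {J : Finset (B1Eq324BenfattoLemma.Site d)}

/-- **`H_{R,S}` as the sum over the crossing tuples** (`R ∩ S = ∅`). [cite: BenfattoEtAl1978, (5.6) p.154] -/
theorem interaction_eq_sum_crossT (hJ : CoefSupportedIn a J) {R S : Finset (B1Eq324BenfattoLemma.Site d)} (hRS : Disjoint R S)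
    (z : B1Eq324BenfattoLemma.Site d → ℝ) :
    interaction s D κ a R S z = ∑ p ∈ Finset.Icc 1 s, ∑ Δ ∈ crossT J p R S, ∑ n ∈ admissible p D, term κ a z p Δ n := by
  rw [interaction, hamiltonian_eq_sum_tuplesIn hJ, hamiltonian_eq_sum_tuplesIn hJ, hamiltonian_eq_sum_tuplesIn hJ,
    ← Finset.sum_sub_distrib, ← Finset.sum_sub_distrib]
  refine Finset.sum_congr rfl fun p hp => ?_
  have hp1 : 0 < p := (Finset.mem_Icc.mp hp).1
  have hsub : tuplesIn J p R ∪ tuplesIn J p S ⊆ tuplesIn J p (R ∪ S) :=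
    Finset.union_subset (tuplesIn_mono Finset.subset_union_left) (tuplesIn_mono Finset.subset_union_right)
  have h := Finset.sum_sdiff (f := fun Δ => ∑ n ∈ admissible p D, term κ a z p Δ n) hsub
  rw [Finset.sum_union (disjoint_tuplesIn hRS hp1)] at h
  rw [crossT]
  linarith

end Cross

/-! ## §3  (5.24): `H′^{(l)}` is the sum over the tuples reaching from `□′` beyond `Γ₃(□)`, hence `O(e^{−(ϰ/4)v})` -/

section Bound524

variable {s D : ℕ} {κ : ℝ} {a : Coef d} {J : Finset (B1Eq324BenfattoLemma.Site d)} {L w v : ℕ}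
  {m : B1Eq324BenfattoLemma.Site d}

/-- The `Γ₃`-crossing tuples are `Γ₂`-crossing tuples (`v ≤ w`). [cite: BenfattoEtAl1978, (5.23) p.157] -/
theorem crossT_frame3_subset {p : ℕ} (hv : v ≤ w) :
    crossT J p (core L w m) (frame3 L w v m) ⊆ crossT J p (core L w m) (frame2 L w m) := by
  intro Δ hΔ
  rw [mem_crossT] at hΔ ⊢
  obtain ⟨hall, hncore, hn3⟩ := hΔ
  refine ⟨fun i => ?_, hncore, fun h2 => ?_⟩
  · rcases Finset.mem_union.mp (hall i) with h | h
    · exact Finset.mem_union_left _ h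
    · exact Finset.mem_union_right _ (frame3_subset_frame2 L hv m h)
  · -- all in Γ₂: then no tessera is in □′, so all are in Γ₃ — contradiction
    refine hn3 fun i => ?_
    rcases Finset.mem_union.mp (hall i) with h | h
    · exact absurd h (Finset.disjoint_right.mp (disjoint_core_frame2 L w m) (h2 i))
    · exact h

/-- **`H′^{(l)}` in tuple form**: the sum over the `□′`/`Γ₂` crossing tuples that are not `□′`/`Γ₃` crossing tuples.
[cite: BenfattoEtAl1978, (5.23) p.157] -/
theorem psi3_eq_sum (hJ : CoefSupportedIn a J) (hv : v ≤ w) (z : B1Eq324BenfattoLemma.Site d → ℝ) :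
    psi3 s D κ a L w v m z = ∑ p ∈ Finset.Icc 1 s,
      ∑ Δ ∈ crossT J p (core L w m) (frame2 L w m) \ crossT J p (core L w m) (frame3 L w v m),
        ∑ n ∈ admissible p D, term κ a z p Δ n := by
  rw [psi3_eq_interaction_sub, interaction_eq_sum_crossT hJ (disjoint_core_frame2 L w m),
    interaction_eq_sum_crossT hJ (disjoint_core_frame3 L w v m), ← Finset.sum_sub_distrib]
  refine Finset.sum_congr rfl fun p _ => ?_
  have h := Finset.sum_sdiff (f := fun Δ => ∑ n ∈ admissible p D, term κ a z p Δ n) (crossT_frame3_subset (J := J) (p := p)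
    (L := L) (m := m) hv)
  linarith

/-- **Separation across a corridor, general form**: a site at depth `≥ j + v` of the tessera and a site NOT at depth `≥ j` are `≥ v`
apart (the corridor `annulus j (j+v)` of width `v` lies between). [cite: BenfattoEtAl1978, (5.7) p.154, (5.24) p.157] -/
theorem le_cubeDist_of_mem_shrink_of_not_mem_shrink {j : ℕ} {x y : B1Eq324BenfattoLemma.Site d}
    (hx : x ∈ shrink L m (j + v)) (hy : y ∉ shrink L m j) : (v : ℝ) ≤ cubeDist x y := by
  rw [mem_shrink_iff] at hx hy
  push Not at hy
  obtain ⟨k, hk⟩ := hy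
  obtain ⟨hx1, hx2⟩ := hx k
  push_cast at hx1 hx2
  refine le_trans ?_ (gap_le_cubeDist x y k)
  refine le_trans ?_ (le_max_left _ _)
  by_cases h1 : m k * (L : ℤ) + j ≤ y k
  · have h2 := hk h1
    have h' : ((v : ℝ) + 1) ≤ (y k : ℝ) - (x k : ℝ) := by
      have : (v : ℤ) + 1 ≤ y k - x k := by linarith
      exact_mod_cast this
    have := neg_abs_le ((x k : ℝ) - (y k : ℝ))
    rw [abs_sub_comm] at this ⊢
    have := le_abs_self ((y k : ℝ) - (x k : ℝ))
    linarith
  · push Not at h1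
    have h' : ((v : ℝ) + 1) ≤ (x k : ℝ) - (y k : ℝ) := by
      have : (v : ℤ) + 1 ≤ x k - y k := by linarith
      exact_mod_cast this
    have := le_abs_self ((x k : ℝ) - (y k : ℝ))
    linarith

/-- **Every tuple of `H′^{(l)}` reaches from `□′` beyond `Γ₃(□)`: `d(Δ) ≥ v`** (`v ≤ 2w`). [cite: BenfattoEtAl1978, (5.24) p.157] -/
theorem le_connLength_of_mem_psi3Class {p : ℕ} (hv : v ≤ 2 * w) {Δ : Fin p → J}
    (hΔ : Δ ∈ crossT J p (core L w m) (frame2 L w m) \ crossT J p (core L w m) (frame3 L w v m)) :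
    (v : ℝ) ≤ connLength fun i => (Δ i : B1Eq324BenfattoLemma.Site d) := by
  rw [Finset.mem_sdiff, mem_crossT, mem_crossT] at hΔ
  obtain ⟨⟨hall, hncore, hn2⟩, hnot3⟩ := hΔ
  -- a tessera in the core
  have hcore : ∃ i, (Δ i : B1Eq324BenfattoLemma.Site d) ∈ core L w m := by
    by_contra h
    push Not at h
    exact hn2 fun i => (Finset.mem_union.mp (hall i)).resolve_left (h i)
  obtain ⟨i, hi⟩ := hcore
  -- a tessera outside `□′ ∪ Γ₃ = shrink (2w − v)`
  have hout : ∃ j, (Δ j : B1Eq324BenfattoLemma.Site d) ∉ shrink L m (2 * w - v) := by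
    by_contra h
    push Not at h
    refine hnot3 ⟨fun j => ?_, hncore, fun h3 => ?_⟩
    · rw [core_union_frame3]
      exact h j
    · exact Finset.disjoint_left.mp (disjoint_core_frame3 L w v m) hi (h3 i)
  obtain ⟨j, hj⟩ := hout
  have hi' : (Δ i : B1Eq324BenfattoLemma.Site d) ∈ shrink L m (2 * w - v + v) := by
    rw [Nat.sub_add_cancel hv]
    exact hi
  exact (le_cubeDist_of_mem_shrink_of_not_mem_shrink hi' hj).trans
    (cubeDist_le_connLength (fun k => (Δ k : B1Eq324BenfattoLemma.Site d)) i j)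

/-- **Anchored counting**: summing the decay factor at rate `c` over the `(p'+1)`-tuples of `J` whose FIRST tessera lies in `R` costs
`|J ∩ R|·K^{p'}` (the other tesserae summed freely). [cite: BenfattoEtAl1978, (5.24) p.157] -/
theorem sum_exp_anchored_le {c : ℝ} (hc : 0 < c) (p : ℕ) (R : Finset (B1Eq324BenfattoLemma.Site d)) :
    ∑ Δ ∈ (Finset.univ : Finset (Fin (p + 1) → J)).filter (fun Δ => ((Δ 0 : J) : B1Eq324BenfattoLemma.Site d) ∈ R),
        Real.exp (-(c * connLength fun i => (Δ i : B1Eq324BenfattoLemma.Site d))) ≤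
      ((Finset.univ : Finset {x // x ∈ J}).filter fun x : {y // y ∈ J} => x.1 ∈ R).card *
        ((2 / (1 - Real.exp (-(c / (p + 1 : ℕ) / Real.sqrt d))) * Real.exp (c / (p + 1 : ℕ) / Real.sqrt d)) ^ d) ^ p := by
  classical
  set c' : ℝ := c / (p + 1 : ℕ) with hc'
  set K : ℝ := (2 / (1 - Real.exp (-(c' / Real.sqrt d))) * Real.exp (c' / Real.sqrt d)) ^ d with hK
  have hc'0 : 0 < c' := div_pos hc (by exact_mod_cast Nat.succ_pos p)
  set g : B1Eq324BenfattoLemma.Site d → B1Eq324BenfattoLemma.Site d → ℝ := fun x y => Real.exp (-(c' * cubeDist x y)) with hg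
  have hg0 : ∀ x y : B1Eq324BenfattoLemma.Site d, 0 ≤ g x y := fun x y => (Real.exp_pos _).le
  have hgxx : ∀ x : J, g x x = 1 := by
    intro x
    have hz : ∀ j : Fin d, max (|(((x : B1Eq324BenfattoLemma.Site d) j : ℤ) : ℝ) - (((x : B1Eq324BenfattoLemma.Site d) j : ℤ) : ℝ)| - 1) 0 ^ 2
        = 0 := by
      intro j
      rw [sub_self, abs_zero, zero_sub, max_eq_right (by norm_num : (-1 : ℝ) ≤ 0)]
      ring
    simp only [hg, cubeDist, hz, Finset.sum_const_zero, Real.sqrt_zero, mul_zero, neg_zero, Real.exp_zero]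
  -- indicator-weighted summand on all tuples
  set F : (Fin (p + 1) → J) → ℝ := fun Δ =>
    if ((Δ 0 : J) : B1Eq324BenfattoLemma.Site d) ∈ R then ∏ i : Fin (p + 1), g (Δ 0) (Δ i) else 0 with hF
  have h1 : ∑ Δ ∈ (Finset.univ : Finset (Fin (p + 1) → J)).filter (fun Δ => ((Δ 0 : J) : B1Eq324BenfattoLemma.Site d) ∈ R),
      Real.exp (-(c * connLength fun i => (Δ i : B1Eq324BenfattoLemma.Site d))) ≤ ∑ Δ, F Δ := by
    rw [← Finset.sum_filter_add_sum_filter_not Finset.univ (fun Δ : Fin (p + 1) → J =>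
      ((Δ 0 : J) : B1Eq324BenfattoLemma.Site d) ∈ R) F]
    have hzero : ∑ Δ ∈ Finset.univ.filter (fun Δ : Fin (p + 1) → J => ¬ ((Δ 0 : J) : B1Eq324BenfattoLemma.Site d) ∈ R), F Δ = 0 :=
      Finset.sum_eq_zero fun Δ hΔ => by
        simp only [hF]
        rw [if_neg (Finset.mem_filter.mp hΔ).2]
    rw [hzero, add_zero]
    refine Finset.sum_le_sum fun Δ hΔ => ?_
    have hmem := (Finset.mem_filter.mp hΔ).2
    simp only [hF]
    rw [if_pos hmem]
    have h := exp_neg_mul_connLength_le_prod (fun i => (Δ i : B1Eq324BenfattoLemma.Site d)) 0 hc.le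
    simpa only [hg, hc', Nat.cast_add, Nat.cast_one] using h
  -- split off the anchor
  have h2 : ∑ Δ, F Δ = ∑ x : J, if (x : B1Eq324BenfattoLemma.Site d) ∈ R then ∏ _i : Fin p, ∑ y : J, g x y else 0 := by
    rw [Fintype.sum_equiv (Fin.consEquiv fun _ : Fin (p + 1) => (J : Type _)).symm F
      (fun q : J × (Fin p → J) => if (q.1 : B1Eq324BenfattoLemma.Site d) ∈ R then ∏ i : Fin p, g q.1 (q.2 i) else 0) ?_]
    · rw [Fintype.sum_prod_type]
      refine Finset.sum_congr rfl fun x _ => ?_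
      by_cases hx : (x : B1Eq324BenfattoLemma.Site d) ∈ R
      · simp only [if_pos hx]
        rw [Finset.prod_univ_sum (fun _ : Fin p => (Finset.univ : Finset {x // x ∈ J})) (fun _ y => g x y), Fintype.piFinset_univ]
      · simp only [if_neg hx, Finset.sum_const_zero]
    · intro Δ
      show F Δ = if ((Δ 0 : J) : B1Eq324BenfattoLemma.Site d) ∈ R then ∏ i : Fin p, g (Δ 0) (Fin.tail Δ i) else 0
      simp only [hF]
      by_cases hx : ((Δ 0 : J) : B1Eq324BenfattoLemma.Site d) ∈ R
      · rw [if_pos hx, if_pos hx, Fin.prod_univ_succ, hgxx, one_mul]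
        rfl
      · rw [if_neg hx, if_neg hx]
  have h3 : ∀ x : J, ∑ y : J, g x y ≤ K := by
    intro x
    rw [Finset.sum_coe_sort (s := J) (f := fun y => g x y)]
    exact sum_exp_neg_mul_cubeDist_le hc'0 J x
  calc _ ≤ ∑ Δ, F Δ := h1
    _ = ∑ x : J, if (x : B1Eq324BenfattoLemma.Site d) ∈ R then ∏ _i : Fin p, ∑ y : J, g x y else 0 := h2
    _ ≤ ∑ x : J, if (x : B1Eq324BenfattoLemma.Site d) ∈ R then K ^ p else 0 := by
        refine Finset.sum_le_sum fun x _ => ?_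
        by_cases hx : (x : B1Eq324BenfattoLemma.Site d) ∈ R
        · rw [if_pos hx, if_pos hx, Finset.prod_const, Finset.card_univ, Fintype.card_fin]
          exact pow_le_pow_left₀ (Finset.sum_nonneg fun y _ => hg0 _ _) (h3 x) p
        · rw [if_neg hx, if_neg hx]
    _ = ((Finset.univ : Finset {x // x ∈ J}).filter fun x : {y // y ∈ J} => x.1 ∈ R).card * K ^ p := by
        rw [← Finset.sum_filter, Finset.sum_const, nsmul_eq_mul]

/-- The anchors inside `R` number at most `|R|`. [cite: BenfattoEtAl1978, (5.24) p.157] -/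
theorem card_filter_coe_mem_le (R : Finset (B1Eq324BenfattoLemma.Site d)) :
    ((Finset.univ : Finset {x // x ∈ J}).filter fun x : {y // y ∈ J} => x.1 ∈ R).card ≤ R.card := by
  classical
  refine Finset.card_le_card_of_injOn (fun x : J => (x : B1Eq324BenfattoLemma.Site d)) (fun x hx => ?_) ?_
  · exact (Finset.mem_filter.mp (Finset.mem_coe.mp hx)).2
  · intro x _ y _ hxy
    exact Subtype.ext hxy

/-- The number of sites of a shrunk tessera is at most `L^d` (print: `|□| = b^{2d}`). [cite: BenfattoEtAl1978, (5.24) p.157] -/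
theorem card_shrink_le (L : ℕ) (m : B1Eq324BenfattoLemma.Site d) (k : ℕ) : (shrink L m k).card ≤ L ^ d := by
  calc (shrink L m k).card ≤ (box L m).card := Finset.card_le_card (shrink_subset_box L m k)
    _ = L ^ d := by
        rw [B1Eq324BenfattoSect5Boxes.box, Fintype.card_piFinset]
        simp only [Int.card_Ico, add_sub_cancel_left, Int.toNat_natCast, Finset.prod_const, Finset.card_univ,
          Fintype.card_fin]

/-- **(5.24) — THE PART OF `Ψ_□` REACHING FROM `□′` ACROSS `Γ₃(□)` IS EXPONENTIALLY SMALL**: p. 157, *"H′^{(l)} can be bounded by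
|H′^{(l)}χ^□_b| ≦ s₁Ab^{D+2d}e^{−(ϰ/8)b^{3/2}} (5.24)"*.  PROVED for the tree's objects: with the extension convention, `|A| ≤ A`, `|z_Δ| ≤ b`
on `J`, `b ≥ 1`, and the `Γ₃`-width `v ≤ w`: `|Ψ₃(z)| ≤ s₁ · A · b^D · e^{−(ϰ/4)v} · |□′∪Γ₂(□)|` — print: `v = ½b^{3/2}` (so `e^{−(ϰ/8)b^{3/2}}`)
and `|□′∪Γ₂(□)| ≤ L^d = b^{2d}` (so `b^{D+2d}`, `card_shrink_le`).  Same mechanism as (5.11): `psi3_eq_sum`, `le_connLength_of_mem_psi3Class`,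
`abs_term_le`, anchored counting `sum_exp_anchored_le`. [cite: BenfattoEtAl1978, (5.24) p.157] -/
theorem abs_psi3_le (hκ : 0 < κ) (hJ : CoefSupportedIn a J) {A : ℝ}
    (hA : ∀ (p : ℕ) (Δ : Fin p → B1Eq324BenfattoLemma.Site d) (n : Fin p → ℕ), |a p Δ n| ≤ A)
    (hv : v ≤ w) {z : B1Eq324BenfattoLemma.Site d → ℝ} {b : ℝ} (hb : 1 ≤ b) (hz : ∀ x ∈ J, |z x| ≤ b) :
    |psi3 s D κ a L w v m z| ≤ s1Const s D d κ * A * b ^ D * Real.exp (-(κ / 4 * v)) * (shrink L m w).card := by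
  classical
  rw [psi3_eq_sum hJ hv]
  have hA0 : 0 ≤ A := (abs_nonneg _).trans (hA 0 Fin.elim0 Fin.elim0)
  have hv2 : v ≤ 2 * w := by omega
  -- the class is anchored in `shrink w` at the first tessera, and every member has `d ≥ v`
  have hsub : ∀ p : ℕ, crossT J p (core L w m) (frame2 L w m) \ crossT J p (core L w m) (frame3 L w v m) ⊆
      (Finset.univ : Finset (Fin p → J)).filter
        (fun Δ => ∀ i, ((Δ i : J) : B1Eq324BenfattoLemma.Site d) ∈ shrink L m w) := by
    intro p Δ hΔ
    rw [Finset.mem_sdiff, mem_crossT] at hΔ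
    refine Finset.mem_filter.mpr ⟨Finset.mem_univ _, fun i => ?_⟩
    rw [← core_union_frame2]
    exact hΔ.1.1 i
  have hterm : ∀ {p : ℕ} (Δ : Fin p → J), Δ ∈ crossT J p (core L w m) (frame2 L w m) \ crossT J p (core L w m) (frame3 L w v m) →
      ∀ n ∈ admissible p D, |term κ a z p Δ n| ≤ A * b ^ D * Real.exp (-(κ / 4 * v)) *
        Real.exp (-(κ / 4 * connLength fun i => (Δ i : B1Eq324BenfattoLemma.Site d))) := by
    intro p Δ hΔ n hn
    have h1 := abs_term_le (κ := κ) (D := D) (fun i => (Δ i : B1Eq324BenfattoLemma.Site d)) n z (hA p _ n) hb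
      (fun i => hz _ (Δ i).2) (mem_admissible.mp hn).2
    have hd := le_connLength_of_mem_psi3Class (L := L) (m := m) hv2 hΔ
    have hsplit : Real.exp (-(κ / 2) * connLength fun i => (Δ i : B1Eq324BenfattoLemma.Site d)) ≤
        Real.exp (-(κ / 4 * v)) * Real.exp (-(κ / 4 * connLength fun i => (Δ i : B1Eq324BenfattoLemma.Site d))) := by
      rw [← Real.exp_add, Real.exp_le_exp]
      nlinarith
    calc |term κ a z p Δ n| ≤ A * Real.exp (-(κ / 2) * connLength fun i => (Δ i : B1Eq324BenfattoLemma.Site d)) * b ^ D := h1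
      _ ≤ A * (Real.exp (-(κ / 4 * v)) * Real.exp (-(κ / 4 * connLength fun i => (Δ i : B1Eq324BenfattoLemma.Site d)))) * b ^ D :=
          mul_le_mul_of_nonneg_right (mul_le_mul_of_nonneg_left hsplit hA0) (pow_nonneg (by linarith) D)
      _ = _ := by ring
  -- per degree: the anchored count
  have hcount : ∀ p ∈ Finset.Icc 1 s,
      ∑ Δ ∈ crossT J p (core L w m) (frame2 L w m) \ crossT J p (core L w m) (frame3 L w v m),
        Real.exp (-(κ / 4 * connLength fun i => (Δ i : B1Eq324BenfattoLemma.Site d))) ≤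
      (shrink L m w).card * decayConst κ p d ^ (p - 1) := by
    intro p hp
    have hp1 : 0 < p := (Finset.mem_Icc.mp hp).1
    obtain ⟨p', rfl⟩ := Nat.exists_eq_succ_of_ne_zero hp1.ne'
    have hanch := sum_exp_anchored_le (J := J) (d := d) (c := κ / 4) (by positivity) p' (shrink L m w)
    have hsub' : crossT J (p' + 1) (core L w m) (frame2 L w m) \ crossT J (p' + 1) (core L w m) (frame3 L w v m) ⊆
        (Finset.univ : Finset (Fin (p' + 1) → J)).filter
          (fun Δ => ((Δ 0 : J) : B1Eq324BenfattoLemma.Site d) ∈ shrink L m w) := by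
      intro Δ hΔ
      have h := Finset.mem_filter.mp (hsub (p' + 1) hΔ)
      exact Finset.mem_filter.mpr ⟨h.1, h.2 0⟩
    calc _ ≤ ∑ Δ ∈ (Finset.univ : Finset (Fin (p' + 1) → J)).filter
            (fun Δ => ((Δ 0 : J) : B1Eq324BenfattoLemma.Site d) ∈ shrink L m w),
            Real.exp (-(κ / 4 * connLength fun i => (Δ i : B1Eq324BenfattoLemma.Site d))) :=
          Finset.sum_le_sum_of_subset_of_nonneg hsub' fun Δ _ _ => (Real.exp_pos _).le
      _ ≤ _ := hanch
      _ ≤ (shrink L m w).card * decayConst κ (p' + 1) d ^ (p' + 1 - 1) := by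
          simp only [Nat.add_sub_cancel, decayConst]
          refine mul_le_mul_of_nonneg_right ?_ (pow_nonneg (pow_nonneg (mul_nonneg (div_nonneg (by norm_num) ?_)
            (Real.exp_pos _).le) d) p')
          · exact_mod_cast card_filter_coe_mem_le (J := J) (shrink L m w)
          · rw [sub_nonneg]
            exact Real.exp_le_one_iff.mpr (by
              have : 0 ≤ κ / 4 / ((p' + 1 : ℕ) : ℝ) / Real.sqrt d := by positivity
              push_cast at this ⊢
              linarith)
  -- sum it up (as in (5.11))
  calc |∑ p ∈ Finset.Icc 1 s, ∑ Δ ∈ crossT J p (core L w m) (frame2 L w m) \ crossT J p (core L w m) (frame3 L w v m),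
          ∑ n ∈ admissible p D, term κ a z p Δ n|
      ≤ ∑ p ∈ Finset.Icc 1 s, ∑ Δ ∈ crossT J p (core L w m) (frame2 L w m) \ crossT J p (core L w m) (frame3 L w v m),
          ∑ n ∈ admissible p D, |term κ a z p Δ n| := by
        refine (Finset.abs_sum_le_sum_abs _ _).trans (Finset.sum_le_sum fun p _ => ?_)
        refine (Finset.abs_sum_le_sum_abs _ _).trans (Finset.sum_le_sum fun Δ _ => ?_)
        exact Finset.abs_sum_le_sum_abs _ _
    _ ≤ ∑ p ∈ Finset.Icc 1 s, ∑ Δ ∈ crossT J p (core L w m) (frame2 L w m) \ crossT J p (core L w m) (frame3 L w v m),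
          ∑ _n ∈ admissible p D, A * b ^ D * Real.exp (-(κ / 4 * v)) *
            Real.exp (-(κ / 4 * connLength fun i => (Δ i : B1Eq324BenfattoLemma.Site d))) :=
        Finset.sum_le_sum fun p _ => Finset.sum_le_sum fun Δ hΔ => Finset.sum_le_sum fun n hn => hterm Δ hΔ n hn
    _ = ∑ p ∈ Finset.Icc 1 s, A * b ^ D * Real.exp (-(κ / 4 * v)) * ((admissible p D).card *
          ∑ Δ ∈ crossT J p (core L w m) (frame2 L w m) \ crossT J p (core L w m) (frame3 L w v m),
            Real.exp (-(κ / 4 * connLength fun i => (Δ i : B1Eq324BenfattoLemma.Site d)))) := by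
        refine Finset.sum_congr rfl fun p _ => ?_
        simp only [Finset.sum_const, nsmul_eq_mul]
        rw [Finset.mul_sum, Finset.mul_sum]
        refine Finset.sum_congr rfl fun Δ _ => ?_
        ring
    _ ≤ ∑ p ∈ Finset.Icc 1 s, A * b ^ D * Real.exp (-(κ / 4 * v)) * ((admissible p D).card *
          ((shrink L m w).card * decayConst κ p d ^ (p - 1))) := by
        refine Finset.sum_le_sum fun p hp => ?_
        exact mul_le_mul_of_nonneg_left (mul_le_mul_of_nonneg_left (hcount p hp) (Nat.cast_nonneg _)) (by positivity)
    _ = s1Const s D d κ * A * b ^ D * Real.exp (-(κ / 4 * v)) * (shrink L m w).card := by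
        rw [s1Const, Finset.sum_mul, Finset.sum_mul, Finset.sum_mul, Finset.sum_mul]
        refine Finset.sum_congr rfl fun p _ => ?_
        ring

/-- **(5.24) with print's volume factor**: `|Ψ₃(z)| ≤ s₁ · A · b^D · e^{−(ϰ/4)v} · L^d` (`L^d = b^{2d}` for print's `L = b²`).
[cite: BenfattoEtAl1978, (5.24) p.157] -/
theorem abs_psi3_le' (hκ : 0 < κ) (hJ : CoefSupportedIn a J) {A : ℝ}
    (hA : ∀ (p : ℕ) (Δ : Fin p → B1Eq324BenfattoLemma.Site d) (n : Fin p → ℕ), |a p Δ n| ≤ A)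
    (hv : v ≤ w) {z : B1Eq324BenfattoLemma.Site d → ℝ} {b : ℝ} (hb : 1 ≤ b) (hz : ∀ x ∈ J, |z x| ≤ b) :
    |psi3 s D κ a L w v m z| ≤ s1Const s D d κ * A * b ^ D * Real.exp (-(κ / 4 * v)) * (L : ℝ) ^ d := by
  refine (abs_psi3_le hκ hJ hA hv hb hz).trans ?_
  have hs1 : 0 ≤ s1Const s D d κ * A * b ^ D * Real.exp (-(κ / 4 * v)) := by
    have hA0 : 0 ≤ A := (abs_nonneg _).trans (hA 0 Fin.elim0 Fin.elim0)
    have : 0 ≤ s1Const s D d κ := Finset.sum_nonneg fun p _ => mul_nonneg (Nat.cast_nonneg _)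
      (pow_nonneg (pow_nonneg (mul_nonneg (div_nonneg (by norm_num) ?_) (Real.exp_pos _).le) d) _)
    · positivity
    · rw [sub_nonneg]
      exact Real.exp_le_one_iff.mpr (by
        have : 0 ≤ κ / 4 / (p : ℝ) / Real.sqrt d := by positivity
        linarith)
  refine mul_le_mul_of_nonneg_left ?_ hs1
  exact_mod_cast card_shrink_le L m w

end Bound524

/-! ## §4  (5.27): `Ψ″₁ = Ψ₁ − Ψ′₁` lives on the tuples meeting `□′ ∖ Γ₄(□)` -/

section Eq527

variable {s D : ℕ} {κ : ℝ} {a : Coef d} {J : Finset (B1Eq324BenfattoLemma.Site d)} {L w v : ℕ}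
  {m : B1Eq324BenfattoLemma.Site d}

/-- The `Γ₄`/`Γ₃` crossing tuples are `□′`/`Γ₃` crossing tuples. [cite: BenfattoEtAl1978, (5.27) p.157] -/
theorem crossT_frame4_subset {p : ℕ} :
    crossT J p (frame4 L w v m) (frame3 L w v m) ⊆ crossT J p (core L w m) (frame3 L w v m) := by
  intro Δ hΔ
  rw [mem_crossT] at hΔ ⊢
  obtain ⟨hall, hn4, hn3⟩ := hΔ
  refine ⟨fun i => ?_, fun hc => ?_, hn3⟩
  · rcases Finset.mem_union.mp (hall i) with h | h
    · exact Finset.mem_union_left _ (frame4_subset_core L w v m h)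
    · exact Finset.mem_union_right _ h
  · -- all in □′: then none in Γ₃, so all in Γ₄ — contradiction
    refine hn4 fun i => ?_
    rcases Finset.mem_union.mp (hall i) with h | h
    · exact h
    · exact absurd h (Finset.disjoint_left.mp (disjoint_core_frame3 L w v m) (hc i))

/-- **(5.27)'s «feature to be retained», in tuple form**: `Ψ″₁ = Ψ₁ − Ψ′₁` is the sum over the `□′`-tuples not inside `Γ₄(□)` plus the
`□′`/`Γ₃` crossing tuples that are not `Γ₄`/`Γ₃` crossing tuples. [cite: BenfattoEtAl1978, (5.27) p.157] -/
theorem psi1pp_eq_sum (hJ : CoefSupportedIn a J) (z : B1Eq324BenfattoLemma.Site d → ℝ) :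
    psi1pp s D κ a L w v m z = ∑ p ∈ Finset.Icc 1 s,
      (∑ Δ ∈ tuplesIn J p (core L w m) \ tuplesIn J p (frame4 L w v m), ∑ n ∈ admissible p D, term κ a z p Δ n
        + ∑ Δ ∈ crossT J p (core L w m) (frame3 L w v m) \ crossT J p (frame4 L w v m) (frame3 L w v m),
            ∑ n ∈ admissible p D, term κ a z p Δ n) := by
  have hd43 : Disjoint (frame4 L w v m) (frame3 L w v m) :=
    Finset.disjoint_of_subset_left (frame4_subset_core L w v m) (disjoint_core_frame3 L w v m)
  rw [psi1pp, psi1, psi1p, hamiltonian_eq_sum_tuplesIn hJ, hamiltonian_eq_sum_tuplesIn hJ,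
    interaction_eq_sum_crossT hJ (disjoint_core_frame3 L w v m), interaction_eq_sum_crossT hJ hd43,
    ← Finset.sum_add_distrib, ← Finset.sum_add_distrib, ← Finset.sum_sub_distrib]
  refine Finset.sum_congr rfl fun p _ => ?_
  have h1 := Finset.sum_sdiff (f := fun Δ => ∑ n ∈ admissible p D, term κ a z p Δ n)
    (tuplesIn_mono (J := J) (p := p) (frame4_subset_core L w v m))
  have h2 := Finset.sum_sdiff (f := fun Δ => ∑ n ∈ admissible p D, term κ a z p Δ n)
    (crossT_frame4_subset (J := J) (p := p) (L := L) (w := w) (v := v) (m := m))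
  linarith

/-- **«each monomial contains at least one z_Δ with Δ ⊂ □′ ∖ Γ₄(□)»**: every tuple of `Ψ″₁` has a tessera in `□′ ∖ Γ₄(□) =
shrink (2w + v)`. [cite: BenfattoEtAl1978, (5.27) p.157] -/
theorem exists_mem_core_sdiff_frame4 {p : ℕ} {Δ : Fin p → J}
    (hΔ : Δ ∈ tuplesIn J p (core L w m) \ tuplesIn J p (frame4 L w v m) ∪
      crossT J p (core L w m) (frame3 L w v m) \ crossT J p (frame4 L w v m) (frame3 L w v m)) :
    ∃ i, ((Δ i : J) : B1Eq324BenfattoLemma.Site d) ∈ shrink L m (2 * w + v) := by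
  rw [← core_sdiff_frame4]
  rcases Finset.mem_union.mp hΔ with h | h
  · rw [Finset.mem_sdiff, mem_tuplesIn, mem_tuplesIn] at h
    obtain ⟨hcore, hn4⟩ := h
    push Not at hn4
    obtain ⟨i, hi⟩ := hn4
    exact ⟨i, Finset.mem_sdiff.mpr ⟨hcore i, hi⟩⟩
  · rw [Finset.mem_sdiff, mem_crossT, mem_crossT] at h
    obtain ⟨⟨hall, hncore, hn3⟩, hnot⟩ := h
    by_contra hcon
    push Not at hcon
    -- every □′-tessera of Δ lies in Γ₄: then Δ is a Γ₄/Γ₃ crossing tuple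
    refine hnot ⟨fun i => ?_, fun h4 => hncore fun i => frame4_subset_core L w v m (h4 i), hn3⟩
    rcases Finset.mem_union.mp (hall i) with h | h
    · by_cases h4 : ((Δ i : J) : B1Eq324BenfattoLemma.Site d) ∈ frame4 L w v m
      · exact Finset.mem_union_left _ h4
      · exact absurd (Finset.mem_sdiff.mpr ⟨h, h4⟩) (hcon i)
    · exact Finset.mem_union_right _ h

end Eq527

/-! ## §5  (5.24) with the coefficient bound only on the range of (4.5) (v1.1; ref-G READ175 NIT-1 applied here too) -/

section Range

variable {s D : ℕ} {κ : ℝ} {a a' : Coef d} {J : Finset (B1Eq324BenfattoLemma.Site d)} {L w v : ℕ}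
  {m : B1Eq324BenfattoLemma.Site d}

/-- Two coefficient families agreeing on the index range of (4.5) give the same `Ψ₃ = H′^{(l)}`. [cite: BenfattoEtAl1978, (5.23) p.157] -/
theorem psi3_congr_coef (z : B1Eq324BenfattoLemma.Site d → ℝ)
    (h : ∀ p ∈ Finset.Icc 1 s, ∀ (Δ : Fin p → B1Eq324BenfattoLemma.Site d), ∀ n ∈ admissible p D, a p Δ n = a' p Δ n) :
    psi3 s D κ a L w v m z = psi3 s D κ a' L w v m z := by
  simp only [psi3, psi1, psi2, psiBox, interaction, hamiltonian_congr_coef _ z h]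

/-- **(5.24) with print's `A ≡ sup |A^{n}_{Δ}|` over the RANGE of (4.5) only** (coefficient bound for `1 ≤ p ≤ s`, tuples inside `J`,
admissible exponents; reduction to `abs_psi3_le` through the truncated family). [cite: BenfattoEtAl1978, (5.24) p.157] -/
theorem abs_psi3_le_of_range (hκ : 0 < κ) (hJ : CoefSupportedIn a J) {A : ℝ} (hA0 : 0 ≤ A)
    (hA : ∀ p ∈ Finset.Icc 1 s, ∀ (Δ : Fin p → B1Eq324BenfattoLemma.Site d), (∀ i, Δ i ∈ J) →
      ∀ n ∈ admissible p D, |a p Δ n| ≤ A)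
    (hv : v ≤ w) {z : B1Eq324BenfattoLemma.Site d → ℝ} {b : ℝ} (hb : 1 ≤ b) (hz : ∀ x ∈ J, |z x| ≤ b) :
    |psi3 s D κ a L w v m z| ≤ s1Const s D d κ * A * b ^ D * Real.exp (-(κ / 4 * v)) * (shrink L m w).card := by
  classical
  let a' : Coef d := fun p Δ n =>
    if p ∈ Finset.Icc 1 s ∧ (∀ i, Δ i ∈ J) ∧ n ∈ admissible p D then a p Δ n else 0
  have hagree : ∀ p ∈ Finset.Icc 1 s, ∀ (Δ : Fin p → B1Eq324BenfattoLemma.Site d), ∀ n ∈ admissible p D, a p Δ n = a' p Δ n := by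
    intro p hp Δ n hn
    by_cases hΔ : ∀ i, Δ i ∈ J
    · simp only [a']
      rw [if_pos ⟨hp, hΔ, hn⟩]
    · push Not at hΔ
      have h0 : a p Δ n = 0 := hJ p Δ n hΔ
      simp only [a', h0]
      split_ifs <;> rfl
  have hJ' : CoefSupportedIn a' J := by
    intro p Δ n hΔ
    obtain ⟨i, hi⟩ := hΔ
    simp only [a']
    rw [if_neg]
    exact fun h => hi (h.2.1 i)
  have hA' : ∀ (p : ℕ) (Δ : Fin p → B1Eq324BenfattoLemma.Site d) (n : Fin p → ℕ), |a' p Δ n| ≤ A := by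
    intro p Δ n
    simp only [a']
    split_ifs with h
    · exact hA p h.1 Δ h.2.1 n h.2.2
    · rw [abs_zero]
      exact hA0
  rw [psi3_congr_coef z hagree]
  exact abs_psi3_le hκ hJ' hA' hv hb hz

end Range

end Literature.MathematicalPhysics.QuantumFieldTheory.Balaban1983to89.B1Eq324BenfattoSect5Eq524

end
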